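import Literature.NumberTheory.ComplexMultiplication.CMAlgebraProduct
import Literature.NumberTheory.ComplexMultiplication.CMTypeProduct
import Literature.NumberTheory.ComplexMultiplication.CMTypeOnSubalgebra
import Literature.NumberTheory.ComplexMultiplication.CMGaloisSubfield
import Literature.NumberTheory.ComplexMultiplication.SlotwiseIndependentOfLinearlyDisjoint
import Literature.NumberTheory.NumberFields.CMFieldCompositum
import HarnessLib

/-!
# The reflex field of a CM-pair `(E, Φ)`, `E` a CM ALGEBRA (Milne, *Complex Multiplication*, Ch. I §1,
# Prop. 1.16, Def. 1.17, Prop. 1.18)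

Layer `Literature/NumberTheory/ComplexMultiplication`.  Three definitions with bodies (`cmTraceOn`, `reflexFieldOn`,
`cmTypeOnAut`), one scoped `MulAction` instance (`autEmbAction`), theorems; no named fact (D-0026, net debt 0).

THE PRINT.  J. S. Milne, *Complex Multiplication* (course notes) [MilneCM2006], Ch. I §1, «The reflex field of a
CM-pair», pp. 13–14 of the version of July 14, 2020 (open text, read 2026-08-21 as `paper:url-8ccc30e4daab`
p0013–p0014), verbatim:

> «If `σ` is an automorphism of `ℂ` (or `ℚ^al`) and `Φ` is a CM-type on a CM-algebra `E`, then
> `σΦ = {σ ∘ φ | φ ∈ Φ}` is again a CM-type on `E`.³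
> PROPOSITION 1.16 Let `(E, Φ)` be a CM-pair.  The following conditions on a subfield `E*` of `ℚ^al` are
> equivalent: (a) `σ ∈ Gal(ℚ^al/ℚ)` fixes `E*` if and only if `σΦ = Φ`; (b) `E*` is the subfield of `ℚ^al` generated
> by the elements `Σ_{φ∈Φ} φ(a)`, `a ∈ E`.
> PROOF. If `σ ∈ Gal(ℚ^al/ℚ)` permutes the `φ`'s in `Φ`, then clearly it fixes all elements of the form `Σ_{φ∈Φ} φ(a)`.
> Conversely, if `Σ_{φ∈Φ} φ(a) = Σ_{φ∈Φ} (σ ∘ φ)(a)` for all `a ∈ E`, then `{σ ∘ φ | φ ∈ Φ} = Φ` by Dedekind's theorem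
> on the independence of characters […].
> DEFINITION 1.17 The field satisfying the equivalent conditions in the proposition is called the reflex field
> `E*` of `(E, Φ)`.  Note that, in contrast to `E`, which need not even be a field, `E*` is a subfield of `ℚ^al`.
> PROPOSITION 1.18 Let `(E, Φ)` be a CM-pair. (a) The reflex field `E*` of `(E, Φ)` is a CM-field. (b) If
> `(E, Φ) = ∏_{1≤i≤m} (Eᵢ, Φᵢ)`, then `E* = E₁* ⋯ E_m*`. (c) The reflex field of any extension `(E₁, Φ₁)` of `(E, Φ)`
> equals that of `(E, Φ)`.
> PROOF. (a) […] and so `E*` is either CM or totally real (cf. 1.6). As `ιΦ ≠ Φ`, it must be CM. (b) Because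
> `Φ = Φ₁ ⊔ … ⊔ Φₙ` as `Gal(ℚ^al/ℚ)`-sets, `{σ | σΦ = Φ} = ⋂ᵢ {σ | σΦᵢ = Φᵢ}`. (c) Clearly `σΦ₁ = (σΦ)₁`, and so
> `σΦ₁ = Φ₁ ⟺ σΦ = Φ`.»

SETTING (the tree's vocabulary).  CM-pairs `(E, Φ)` with `E` a CM ALGEBRA (a finite product of CM fields) are the
Gao–Ullmo carrier of the tree: `E` a commutative `ℚ`-algebra, `Emb E = (E →ₐ[ℚ] ℂ)`, `CMTypeOn E`
(`GaoUllmo2025/CMHodgeModel`), `IsCMAlgebra E`, products `cmTypeOnProd` / `cmTypeOnPi` and transport `cmTypeOnMap`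
(`CMAlgebraProduct`, `CMTypeProduct`), extensions `cmTypeOnExtend` (`CMTypeOnSubalgebra`).  `ℚ^al` is read inside `ℂ`
and `Gal(ℚ^al/ℚ)` is replaced by `Aut(ℂ/ℚ) = ℂ ≃ₐ[ℚ] ℂ` (Milne: «an automorphism of `ℂ` (or `ℚ^al`)»; every
automorphism of `ℚ^al` extends to `ℂ`), acting on `Hom(E, ℂ)` by composition (`autEmbAction`, scoped).  For a FIELD
the tree already has the reflex field in two forms — Galois side `ReflexType.reflexField F Ω Φ` and complex side
`ComplexReflexField.traceField Φ = ℚ(Σ_{φ∈Φ} φ(x))` (Shimura §8.3 Prop. 28) —; this file is the CM-ALGEBRA case and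
reduces to `traceField` on fields (`reflexFieldOn_cmTypeEquivCMTypeOn`).

WHAT IS PROVED.
* §1 `cmTraceOn Φ : E →ₗ[ℚ] ℂ` (`a ↦ Σ_{φ∈Φ} φ a`) and **`reflexFieldOn Φ := ℚ(tr_Φ(E)) ⊂ ℂ`** — Def. 1.17 in the form
  (b); for a number field `reflexFieldOn (cmTypeEquivCMTypeOn K Φ) = traceField Φ`.
* §2 **PROPOSITION 1.16**: `forall_mem_reflexFieldOn_apply_eq_iff` — `σ` fixes `E*` pointwise iff `σ • Φ = Φ`, with
  Milne's proof (Dedekind's independence of characters = Mathlib `linearIndependent_monoidHom`, packaged as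
  `finset_eq_of_forall_sum_apply_eq`); as subgroups, `fixingSubgroup_reflexFieldOn : Fix(E*) = Stab(Φ)`
  («`Gal(ℚ^al/E*) = {σ | σΦ = Φ}`», p. 14), and `E* ≤` the fixed field of `Stab(Φ)`.
* §3 **PROPOSITION 1.18 (b)**: `reflexFieldOn_cmTypeOnProd` (`(Φ₁ ⊔ Φ₂)* = E₁* · E₂*`), `reflexFieldOn_cmTypeOnPi`
  (`= ⨆ᵢ Eᵢ*`), via `tr_{Φ₁⊔Φ₂}(a₁, a₂) = tr_{Φ₁}(a₁) + tr_{Φ₂}(a₂)`; invariance under isomorphism of CM pairs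
  (`reflexFieldOn_cmTypeOnMap`).
* §4 `E*` is a number field (`finiteDimensional_reflexFieldOn`: generated by the traces of a basis, which are
  algebraic), and **PROPOSITION 1.18 (a)**: `isCMField_reflexFieldOn` — for a non-zero CM algebra `E*` is a CM field
  (through `E ≅ ∏ Kᵢ`, (b), the field case `isCMField_traceField` = the tree's `isCMField_reflexField` transported
  by `lift_reflexField_galoisClosure`, and the compositum theorem `IntermediateField.isCMField_iSup` = Shimura §18.2
  Lemma (ii)).
* §5 footnote 3: on a CM algebra complex conjugation commutes with `Aut(ℂ)` along every embedding
  (`conj_aut_comm_of_isCMAlgebra`, from the tree's Shimura §18.2 Lemma (i) factor-wise), so **`σΦ` is again a CM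
  type** (`cmTypeOnAut`), and Prop. 1.16 reads `(∀ x ∈ E*, σ x = x) ↔ σΦ = Φ`
  (`forall_mem_reflexFieldOn_apply_eq_iff_cmTypeOnAut_eq`).
* §6 **PROPOSITION 1.18 (c)**: `reflexFieldOn_cmTypeOnExtend` — `(E, Φ₀^E)* = (E₀, Φ₀)*` along `i : E₀ → E` whenever
  restriction `Hom(E, ℂ) → Hom(E₀, ℂ)` is onto (the situation of a CM-subalgebra; number fields:
  `reflexFieldOn_cmTypeOnExtend_toAlgHom`, and in the tree's complex vocabulary `traceField_inducedCMType :
  traceField (Φ^L) = traceField Φ`).  Milne's one-line proof «`σΦ₁ = Φ₁ ⟺ σΦ = Φ`» is completed by the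
  Galois-correspondence step `IntermediateField.eq_of_forall_algEquiv_fix_iff` (finite-dimensional subfields of `ℂ`
  with the same pointwise fixer in `Aut(ℂ/ℚ)` coincide; from the tree's `exists_ringEquiv_apply_eq_algHom`).
* §7 Validation on `ℚ(i) × ℚ(i)` (not a field): `E* = φ(ℚ(i)) = ℚ(i) ⊂ ℂ` for `Φ = {φ} ⊔ {φ}`
  (`reflexFieldOn_gaussian_prod`), `E*` is CM for every CM type of `ℚ(i) × ℚ(i)`, and the diagonal extension
  `ℚ(i) ⊂ ℚ(i) × ℚ(i)` does not change `E*`.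

NOT HERE: the reflex CM-pair `(E*, Φ*)` and the reflex norm of a CM-ALGEBRA pair (Milne Ex. 1.19, §1 «The reflex
norm», Prop. 1.21–1.24) — the tree has them for FIELDS (`ReflexCMType`, `ReflexNorm`, `CMTori.reflexNormCochar`).

## References
* [MilneCM2006] J. S. Milne, *Complex Multiplication* (course notes; version July 14, 2020), Ch. I §1: the paragraph
  «The reflex field of a CM-pair» with footnote 3, Proposition 1.16, Definition 1.17, Proposition 1.18 (pp. 13–14).
* [Shimura1998] G. Shimura, *Abelian Varieties with Complex Multiplication and Modular Functions* (1998), §8.3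
  Prop. 28 (the field case `K* = ℚ(Σᵢ ξ^{φᵢ})`, used through the tree), §18.2 Lemma (used through the tree).
* [GaoUllmo2025] Z. Gao, E. Ullmo, J. Inst. Math. Jussieu 25 (2025), §2.1–§2.2 (CM pairs `(E, Φ)` with `E` a CM
  algebra; the carrier).

## Provenance

Lane `lit-hodgefound` (Hodge path, Track 2, Layer A3), prover seat `lit-hodgefound-p27` (generation 2), self-proposed
row «A3.3.1⁺/A3.3.2⁺ (CM algebras) — Milne Prop. 1.16 / Def. 1.17 / Prop. 1.18» (lane INBOX 2026-08-21T07:00:27Z);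
sequel to the seat's `CMAlgebraProduct`, `CMAlgebraCMTypeCount`, `CMTypeOnSubalgebra`.
-/

set_option autoImplicit false

noncomputable section

open scoped Pointwise IntermediateField

namespace Literature.NumberTheory.ComplexMultiplication

open Literature.AlgebraicGeometry.GaoUllmo2025
open Literature.AlgebraicGeometry.Motives (CMType)
open Literature.NumberTheory.NumberFields
open NumberField

/-! ## §1 The type trace and the reflex field (Def. 1.17 in the form of Prop. 1.16 (b)) -/

section Defs

variable {E : Type} [CommRing E] [Algebra ℚ E]

/-- The **type trace** `a ↦ Σ_{φ ∈ Φ} φ(a)` of a CM type `Φ` on a commutative `ℚ`-algebra `E` (the elements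
«`Σ_{φ∈Φ} φ(a)`, `a ∈ E`» of Prop. 1.16 (b)), a `ℚ`-linear map `E → ℂ`. [cite: MilneCM2006, Ch. I §1 Prop. 1.16] -/
def cmTraceOn (Φ : CMTypeOn E) : E →ₗ[ℚ] ℂ := ∑ φ ∈ Φ.Φ, (φ : E →ₐ[ℚ] ℂ).toLinearMap

/-- `tr_Φ(a) = Σ_{φ∈Φ} φ(a)`. [cite: MilneCM2006, Ch. I §1 Prop. 1.16] -/
theorem cmTraceOn_apply (Φ : CMTypeOn E) (a : E) : cmTraceOn Φ a = ∑ φ ∈ Φ.Φ, φ a := by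
  simp [cmTraceOn, LinearMap.sum_apply]

/-- **The reflex field `E*` of a CM-pair `(E, Φ)`** (DEFINITION 1.17), taken in the form of PROPOSITION 1.16 (b):
«`E*` is the subfield of `ℚ^al` generated by the elements `Σ_{φ∈Φ} φ(a)`, `a ∈ E`» — here a subfield of `ℂ`
(«Note that, in contrast to `E`, which need not even be a field, `E*` is a subfield of `ℚ^al`»).  Condition (a)
of Prop. 1.16 is `fixingSubgroup_reflexFieldOn`; for a FIELD `E` this is the tree's complex reflex field
`traceField` (`reflexFieldOn_cmTypeEquivCMTypeOn`). [cite: MilneCM2006, Ch. I §1 Def. 1.17 and Prop. 1.16 (b)] -/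
def reflexFieldOn (Φ : CMTypeOn E) : IntermediateField ℚ ℂ :=
  IntermediateField.adjoin ℚ (Set.range (cmTraceOn Φ))

/-- The generators `tr_Φ(a)` lie in `E*`. [cite: MilneCM2006, Ch. I §1 Prop. 1.16 (b)] -/
theorem cmTraceOn_mem_reflexFieldOn (Φ : CMTypeOn E) (a : E) : cmTraceOn Φ a ∈ reflexFieldOn Φ :=
  IntermediateField.subset_adjoin ℚ _ ⟨a, rfl⟩

/-- `E* ≤ F` iff `F` contains every `tr_Φ(a)`. [cite: MilneCM2006, Ch. I §1 Prop. 1.16 (b)] -/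
theorem reflexFieldOn_le_iff (Φ : CMTypeOn E) (F : IntermediateField ℚ ℂ) :
    reflexFieldOn Φ ≤ F ↔ ∀ a : E, cmTraceOn Φ a ∈ F := by
  rw [reflexFieldOn, IntermediateField.adjoin_le_iff]
  constructor
  · intro h a
    exact h ⟨a, rfl⟩
  · rintro h _ ⟨a, rfl⟩
    exact h a

end Defs

/-! ### For a FIELD, `E*` is the tree's complex reflex field `traceField` -/

section FieldCase

variable (K : Type) [Field K] [NumberField K]

/-- On a number field the type trace of the (G)-avatar `Φ_G` of a complex CM type `Φ` is the tree's
`cmTypeTrace Φ` (same sum, indexed by `Hom(K, ℂ)` as ring maps or as `ℚ`-algebra maps).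
[cite: Shimura1998, §8.3 Prop. 28] -/
theorem cmTraceOn_cmTypeEquivCMTypeOn (Φ : CMType K) (x : K) :
    cmTraceOn (cmTypeEquivCMTypeOn K Φ) x = cmTypeTrace Φ x := by
  classical
  rw [cmTraceOn_apply, cmTypeTrace_apply]
  refine Finset.sum_bij (fun (ψ : Emb K) _ => (ψ : K →+* ℂ)) (fun ψ hψ => ?_) (fun ψ _ ψ' _ h => ?_)
    (fun φ hφ => ?_) (fun ψ _ => rfl)
  · rw [Set.Finite.mem_toFinset]
    exact (mem_cmTypeEquivCMTypeOn_iff K Φ ψ).1 hψ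
  · exact AlgHom.coe_ringHom_injective h
  · refine ⟨φ.toRatAlgHom, ?_, RingHom.ext fun _ => rfl⟩
    rw [toRatAlgHom_mem_cmTypeEquivCMTypeOn_iff]
    exact (Set.Finite.mem_toFinset _).1 hφ

/-- **For a number field, `E*` is the complex reflex field of the tree**: `ℚ(tr_Φ(K)) = traceField Φ`
(Shimura §8.3 Prop. 28 «`K* = ℚ(Σᵢ ξ^{φᵢ} | ξ ∈ F)`»; the tree's `ComplexReflexField`, `CMTypeDictionary` §5).
[cite: MilneCM2006, Ch. I §1 Def. 1.17] [cite: Shimura1998, §8.3 Prop. 28] -/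
theorem reflexFieldOn_cmTypeEquivCMTypeOn (Φ : CMType K) :
    reflexFieldOn (cmTypeEquivCMTypeOn K Φ) = traceField Φ := by
  have h : Set.range (cmTraceOn (cmTypeEquivCMTypeOn K Φ)) = Set.range (cmTypeTrace Φ) := by
    ext z
    simp only [Set.mem_range, cmTraceOn_cmTypeEquivCMTypeOn]
  rw [reflexFieldOn, h, traceField]

end FieldCase

/-! ## §2 PROPOSITION 1.16: `σ` fixes `E*` iff `σΦ = Φ` -/

section Action

variable {E : Type} [CommRing E] [Algebra ℚ E]

variable (E) in
/-- `Aut(ℂ/ℚ) = ℂ ≃ₐ[ℚ] ℂ` (in print `Gal(ℚ^al/ℚ)`, or an automorphism of `ℂ`) acts on `Hom(E, ℂ)` by composition,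
`σ • φ = σ ∘ φ` — the `σΦ := {σ ∘ φ | φ ∈ Φ}` of the print.  Scoped and of low priority: for a FIELD `E` the
tree's (definitionally equal) `EmbeddingAction.algEquivCompAction` takes precedence.
[cite: MilneCM2006, Ch. I §1 (before Prop. 1.16)] -/
scoped instance (priority := low) autEmbAction : MulAction (ℂ ≃ₐ[ℚ] ℂ) (Emb E) where
  smul σ φ := (σ : ℂ →ₐ[ℚ] ℂ).comp φ
  one_smul φ := by ext; rfl
  mul_smul σ τ φ := by ext; rfl

/-- `(σ • φ)(a) = σ(φ(a))`. [cite: MilneCM2006, Ch. I §1 (before Prop. 1.16)] -/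
@[simp] theorem aut_smul_emb_apply (σ : ℂ ≃ₐ[ℚ] ℂ) (φ : Emb E) (a : E) : (σ • φ) a = σ (φ a) := rfl

/-- `σ(tr_Φ(a)) = Σ_{φ∈Φ} (σ • φ)(a) = tr_{σΦ}(a)`: an automorphism moves the type trace of `Φ` to the sum over
the translated type. [cite: MilneCM2006, Ch. I §1 Prop. 1.16 (proof)] -/
theorem apply_cmTraceOn [DecidableEq (Emb E)] (σ : ℂ ≃ₐ[ℚ] ℂ) (Φ : CMTypeOn E) (a : E) :
    σ (cmTraceOn Φ a) = ∑ ψ ∈ Φ.Φ.image (σ • ·), ψ a := by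
  rw [cmTraceOn_apply, map_sum, Finset.sum_image fun φ _ φ' _ h => smul_left_cancel σ h]
  rfl

/-- **Dedekind's theorem on the independence of characters**, in the form used in the proof of Prop. 1.16
(Milne's footnote: «the equation says that `Σ_{φ∈Φ′} φ − Σ_{φ∈Φ} φ = 0`, and Dedekind's theorem says that this
is possible only if each `φ` in `Φ` occurs exactly once in `Φ′`»): two finite sets of `ℚ`-algebra maps `E → ℂ`
with the same sum function `a ↦ Σ φ(a)` are equal (Mathlib `linearIndependent_monoidHom`).
[cite: MilneCM2006, Ch. I §1 Prop. 1.16 (proof, footnote 4)] -/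
theorem finset_eq_of_forall_sum_apply_eq {S T : Finset (Emb E)} (h : ∀ a : E, ∑ ψ ∈ S, ψ a = ∑ φ ∈ T, φ a) :
    S = T := by
  classical
  -- pass to monoid homomorphisms `E →* ℂ`, where Dedekind's independence is available
  let m : Emb E ↪ (E →* ℂ) := ⟨fun φ => (φ : E →* ℂ), fun φ φ' hφ => AlgHom.ext fun a => by
    simpa using DFunLike.congr_fun hφ a⟩
  have hli := linearIndependent_monoidHom E ℂ
  let s : Finset (E →* ℂ) := S.map m ∪ T.map m
  let g : (E →* ℂ) → ℂ := fun f => (if f ∈ S.map m then 1 else 0) - (if f ∈ T.map m then 1 else 0)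
  have hsum : ∑ f ∈ s, g f • (f : E → ℂ) = 0 := by
    have h1 : ∑ f ∈ s, (if f ∈ S.map m then (1 : ℂ) else 0) • (f : E → ℂ) = ∑ f ∈ S.map m, (f : E → ℂ) := by
      simp_rw [ite_smul, one_smul, zero_smul]
      rw [Finset.sum_ite_mem, Finset.inter_eq_right.2 Finset.subset_union_left]
    have h2 : ∑ f ∈ s, (if f ∈ T.map m then (1 : ℂ) else 0) • (f : E → ℂ) = ∑ f ∈ T.map m, (f : E → ℂ) := by
      simp_rw [ite_smul, one_smul, zero_smul]
      rw [Finset.sum_ite_mem, Finset.inter_eq_right.2 Finset.subset_union_right]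
    simp only [g, sub_smul, Finset.sum_sub_distrib, h1, h2, Finset.sum_map]
    ext a
    simp only [Pi.sub_apply, Finset.sum_apply, Pi.zero_apply]
    have := h a
    change ∑ ψ ∈ S, (m ψ : E → ℂ) a - ∑ φ ∈ T, (m φ : E → ℂ) a = 0
    simp only [m, Function.Embedding.coeFn_mk, MonoidHom.coe_coe]
    rw [this, sub_self]
  have hg : ∀ f ∈ s, g f = 0 := linearIndependent_iff'.1 hli s g hsum
  -- read off membership
  have key : ∀ f : E →* ℂ, f ∈ S.map m ↔ f ∈ T.map m := by
    intro f
    by_cases hf : f ∈ s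
    · have hgf := hg f hf
      simp only [g] at hgf
      constructor
      · intro h1
        by_contra h2
        rw [if_pos h1, if_neg h2] at hgf
        norm_num at hgf
      · intro h2
        by_contra h1
        rw [if_neg h1, if_pos h2] at hgf
        norm_num at hgf
    · have h1 : f ∉ S.map m := fun h' => hf (Finset.mem_union_left _ h')
      have h2 : f ∉ T.map m := fun h' => hf (Finset.mem_union_right _ h')
      exact ⟨fun h' => absurd h' h1, fun h' => absurd h' h2⟩
  have hST : S.map m = T.map m := Finset.ext key
  exact Finset.map_injective m hST

/-- If `σ` fixes a complex number then so does every integer power of `σ`. [folklore] -/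
private theorem zpow_apply_eq_self_of_apply_eq_self {σ : ℂ ≃ₐ[ℚ] ℂ} {z : ℂ} (hz : σ z = z) (k : ℤ) :
    (σ ^ k) z = z := by
  have hnat : ∀ n : ℕ, (σ ^ n) z = z := by
    intro n
    induction n with
    | zero => simp
    | succ n ih => rw [pow_succ, AlgEquiv.mul_apply, hz, ih]
  cases k with
  | ofNat n => simpa using hnat n
  | negSucc n =>
    have h := hnat (n + 1)
    rw [zpow_negSucc]
    conv_lhs => rw [← h]
    rw [← AlgEquiv.mul_apply, inv_mul_cancel, AlgEquiv.one_apply]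

/-- **PROPOSITION 1.16** («The following conditions on a subfield `E*` of `ℚ^al` are equivalent: (a) `σ` fixes
`E*` if and only if `σΦ = Φ`; (b) `E*` is the subfield generated by the elements `Σ_{φ∈Φ} φ(a)`, `a ∈ E`»), for
the field `E*` of (b) (`reflexFieldOn`): **`σ ∈ Aut(ℂ/ℚ)` fixes `E*` pointwise iff `σΦ = Φ`**.  Proof as printed:
if `σ` permutes `Φ` it fixes each `Σ φ(a)`; conversely `Σ_{φ∈Φ} σφ(a) = Σ_{φ∈Φ} φ(a)` for all `a` forces
`σΦ = Φ` by Dedekind's independence of characters. [cite: MilneCM2006, Ch. I §1 Prop. 1.16] -/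
theorem forall_mem_reflexFieldOn_apply_eq_iff (Φ : CMTypeOn E) (σ : ℂ ≃ₐ[ℚ] ℂ) :
    (∀ x ∈ reflexFieldOn Φ, σ x = x) ↔ σ • (Φ.Φ : Set (Emb E)) = Φ.Φ := by
  classical
  have himg : σ • (Φ.Φ : Set (Emb E)) = ↑(Φ.Φ.image (σ • ·)) := by
    rw [Finset.coe_image, ← Set.image_smul]
  rw [himg, Finset.coe_inj]
  constructor
  · intro h
    symm
    refine finset_eq_of_forall_sum_apply_eq fun a => ?_
    rw [← apply_cmTraceOn, ← cmTraceOn_apply]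
    exact (h _ (cmTraceOn_mem_reflexFieldOn Φ a)).symm
  · intro h
    -- `σ` fixes the generators, hence the field they generate
    have hgen : ∀ a : E, σ (cmTraceOn Φ a) = cmTraceOn Φ a := fun a => by
      rw [apply_cmTraceOn, h, cmTraceOn_apply]
    intro x hx
    have hle : reflexFieldOn Φ ≤ IntermediateField.fixedField (Subgroup.zpowers σ) := by
      rw [reflexFieldOn_le_iff]
      intro a
      rw [IntermediateField.mem_fixedField_iff]
      intro τ hτ
      obtain ⟨k, rfl⟩ := Subgroup.mem_zpowers_iff.1 hτ
      exact zpow_apply_eq_self_of_apply_eq_self (hgen a) k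
    exact (IntermediateField.mem_fixedField_iff _ _).1 (hle hx) σ (Subgroup.mem_zpowers σ)

/-- **Prop. 1.16 as an identity of subgroups of `Aut(ℂ/ℚ)`**: the pointwise fixer of `E*` is the stabiliser of
`Φ`, «`Gal(ℚ^al/E*) = {σ | σΦ = Φ}`» (p. 14). [cite: MilneCM2006, Ch. I §1 Prop. 1.16 (a)] -/
theorem fixingSubgroup_reflexFieldOn (Φ : CMTypeOn E) :
    (reflexFieldOn Φ).fixingSubgroup = MulAction.stabilizer (ℂ ≃ₐ[ℚ] ℂ) (Φ.Φ : Set (Emb E)) := by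
  ext σ
  rw [IntermediateField.mem_fixingSubgroup_iff, MulAction.mem_stabilizer_iff]
  exact forall_mem_reflexFieldOn_apply_eq_iff Φ σ

/-- Hence `E*` lies in the field fixed by the stabiliser of `Φ` (the tree's `ReflexType.reflexField ℚ ℂ Φ`
with `G = Aut(ℂ/ℚ)`). [cite: MilneCM2006, Ch. I §1 Prop. 1.16] -/
theorem reflexFieldOn_le_fixedField_stabilizer (Φ : CMTypeOn E) :
    reflexFieldOn Φ ≤ IntermediateField.fixedField (MulAction.stabilizer (ℂ ≃ₐ[ℚ] ℂ) (Φ.Φ : Set (Emb E))) := by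
  intro x hx
  rw [IntermediateField.mem_fixedField_iff]
  intro σ hσ
  rw [← fixingSubgroup_reflexFieldOn, IntermediateField.mem_fixingSubgroup_iff] at hσ
  exact hσ x hx

end Action

/-! ## §3 PROPOSITION 1.18 (b): the reflex field of a product is the compositum -/

section Products

variable {E E' : Type} [CommRing E] [Algebra ℚ E] [CommRing E'] [Algebra ℚ E']

/-- The type trace of `Φ₁ ∘ pr₁ ⊔ Φ₂ ∘ pr₂` on `E × E′` is `tr_{Φ₁}(a₁) + tr_{Φ₂}(a₂)`.
[cite: MilneCM2006, Ch. I §1 Prop. 1.18 (b)] -/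
theorem cmTraceOn_cmTypeOnProd (Φ₁ : CMTypeOn E) (Φ₂ : CMTypeOn E') (a : E × E') :
    cmTraceOn (cmTypeOnProd Φ₁ Φ₂) a = cmTraceOn Φ₁ a.1 + cmTraceOn Φ₂ a.2 := by
  rw [cmTraceOn_apply, cmTraceOn_apply, cmTraceOn_apply]
  change ∑ φ ∈ (Φ₁.Φ.disjSum Φ₂.Φ).map ⟨sumEmb, sumEmb_injective⟩, φ a = _
  rw [Finset.sum_map, Finset.sum_disjSum]
  rfl

/-- **PROPOSITION 1.18 (b)** («If `(E, Φ) = ∏ᵢ (Eᵢ, Φᵢ)`, then `E* = E₁* ⋯ E_m*`»), two factors: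
`(E × E′, Φ₁ ⊔ Φ₂)* = E₁* · E₂*` (compositum inside `ℂ`). [cite: MilneCM2006, Ch. I §1 Prop. 1.18 (b)] -/
theorem reflexFieldOn_cmTypeOnProd (Φ₁ : CMTypeOn E) (Φ₂ : CMTypeOn E') :
    reflexFieldOn (cmTypeOnProd Φ₁ Φ₂) = reflexFieldOn Φ₁ ⊔ reflexFieldOn Φ₂ := by
  apply le_antisymm
  · rw [reflexFieldOn_le_iff]
    intro a
    rw [cmTraceOn_cmTypeOnProd]
    exact add_mem ((le_sup_left : reflexFieldOn Φ₁ ≤ reflexFieldOn Φ₁ ⊔ reflexFieldOn Φ₂)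
        (cmTraceOn_mem_reflexFieldOn Φ₁ a.1))
      ((le_sup_right : reflexFieldOn Φ₂ ≤ reflexFieldOn Φ₁ ⊔ reflexFieldOn Φ₂)
        (cmTraceOn_mem_reflexFieldOn Φ₂ a.2))
  · refine sup_le ?_ ?_
    · rw [reflexFieldOn_le_iff]
      intro a
      have h := cmTraceOn_mem_reflexFieldOn (cmTypeOnProd Φ₁ Φ₂) (a, 0)
      rwa [cmTraceOn_cmTypeOnProd, map_zero, add_zero] at h
    · rw [reflexFieldOn_le_iff]
      intro a
      have h := cmTraceOn_mem_reflexFieldOn (cmTypeOnProd Φ₁ Φ₂) (0, a)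
      rwa [cmTraceOn_cmTypeOnProd, map_zero, zero_add] at h

/-- Isomorphic CM pairs have the same type traces: `tr_{e_*Φ}(a′) = tr_Φ(e⁻¹ a′)`.
[cite: GaoUllmo2025, §2.1 (isomorphic CM pairs)] -/
theorem cmTraceOn_cmTypeOnMap (e : E ≃ₐ[ℚ] E') (Φ : CMTypeOn E) (a' : E') :
    cmTraceOn (cmTypeOnMap e Φ) a' = cmTraceOn Φ (e.symm a') := by
  rw [cmTraceOn_apply, cmTraceOn_apply]
  change ∑ φ ∈ Φ.Φ.map (embCongr e).toEmbedding, φ a' = _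
  rw [Finset.sum_map]
  rfl

/-- **Isomorphic CM pairs have the same reflex field** (`E*` is an invariant of the isomorphism class of
`(E, Φ)`, §2.1). [cite: MilneCM2006, Ch. I §1 Def. 1.17] [cite: GaoUllmo2025, §2.1 (isomorphic CM pairs)] -/
theorem reflexFieldOn_cmTypeOnMap (e : E ≃ₐ[ℚ] E') (Φ : CMTypeOn E) :
    reflexFieldOn (cmTypeOnMap e Φ) = reflexFieldOn Φ := by
  have h : Set.range (cmTraceOn (cmTypeOnMap e Φ)) = Set.range (cmTraceOn Φ) := by
    ext z
    simp only [Set.mem_range, cmTraceOn_cmTypeOnMap]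
    constructor
    · rintro ⟨a', rfl⟩; exact ⟨e.symm a', rfl⟩
    · rintro ⟨a, rfl⟩; exact ⟨e a, by rw [AlgEquiv.symm_apply_apply]⟩
  rw [reflexFieldOn, reflexFieldOn, h]

variable {ι : Type} [Fintype ι] {K : ι → Type} [∀ i, Field (K i)] [∀ i, Algebra ℚ (K i)]

/-- The type trace of `⊔ᵢ Ψᵢ ∘ prᵢ` on `∏ᵢ Kᵢ` is `Σᵢ tr_{Ψᵢ}(aᵢ)`. [cite: MilneCM2006, Ch. I §1 Prop. 1.18 (b)] -/
theorem cmTraceOn_cmTypeOnPi (Ψ : (i : ι) → CMTypeOn (K i)) (a : (i : ι) → K i) :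
    cmTraceOn (cmTypeOnPi Ψ) a = ∑ i, cmTraceOn (Ψ i) (a i) := by
  rw [cmTraceOn_apply]
  change ∑ φ ∈ (Finset.univ.sigma fun i => (Ψ i).Φ).map ⟨sigmaEmb, sigmaEmb_injective⟩, φ a = _
  rw [Finset.sum_map, Finset.sum_sigma]
  refine Finset.sum_congr rfl fun i _ => ?_
  rw [cmTraceOn_apply]
  rfl

/-- **PROPOSITION 1.18 (b)** for a finite product of fields: `(∏ᵢ Kᵢ, ⊔ᵢ Ψᵢ)* = ∏ᵢ Kᵢ*` (compositum `⨆ᵢ` in `ℂ`).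
[cite: MilneCM2006, Ch. I §1 Prop. 1.18 (b)] -/
theorem reflexFieldOn_cmTypeOnPi (Ψ : (i : ι) → CMTypeOn (K i)) :
    reflexFieldOn (cmTypeOnPi Ψ) = ⨆ i, reflexFieldOn (Ψ i) := by
  classical
  apply le_antisymm
  · rw [reflexFieldOn_le_iff]
    intro a
    rw [cmTraceOn_cmTypeOnPi]
    exact sum_mem fun i _ => (le_iSup (fun i => reflexFieldOn (Ψ i)) i) (cmTraceOn_mem_reflexFieldOn _ _)
  · refine iSup_le fun i => ?_
    rw [reflexFieldOn_le_iff]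
    intro a
    have h := cmTraceOn_mem_reflexFieldOn (cmTypeOnPi Ψ) (Pi.single i a)
    rw [cmTraceOn_cmTypeOnPi, Finset.sum_eq_single i (fun j _ hji => by
      rw [Pi.single_eq_of_ne hji, map_zero]) (fun hi => absurd (Finset.mem_univ i) hi), Pi.single_eq_same] at h
    exact h

end Products

/-! ## §4 `E*` is finite over `ℚ`; PROPOSITION 1.18 (a): `E*` is a CM field -/

section Finite

variable {E : Type} [CommRing E] [Algebra ℚ E]

/-- `E*` is generated by the type traces of a `ℚ`-basis of `E` (the type trace is `ℚ`-linear).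
[cite: MilneCM2006, Ch. I §1 Prop. 1.16 (b)] -/
theorem reflexFieldOn_eq_adjoin_range_basis {ιb : Type} (b : Module.Basis ιb ℚ E) (Φ : CMTypeOn E) :
    reflexFieldOn Φ = IntermediateField.adjoin ℚ (Set.range fun i => cmTraceOn Φ (b i)) := by
  apply le_antisymm
  · rw [reflexFieldOn_le_iff]
    intro a
    rw [← b.linearCombination_repr a, Finsupp.linearCombination_apply, map_finsuppSum]
    refine sum_mem fun i _ => ?_
    show cmTraceOn Φ ((b.repr a i) • b i) ∈ _
    rw [map_smul]
    refine IntermediateField.smul_mem _ (IntermediateField.subset_adjoin ℚ _ ?_)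
    exact ⟨i, rfl⟩
  · rw [IntermediateField.adjoin_le_iff]
    rintro _ ⟨i, rfl⟩
    exact cmTraceOn_mem_reflexFieldOn Φ (b i)

/-- The type traces are algebraic integers' worth: `tr_Φ(a)` is integral over `ℚ` for `E` finite over `ℚ`
(a sum of conjugates of algebraic numbers). [cite: MilneCM2006, Ch. I §1 Prop. 1.16 (b)] -/
theorem isIntegral_cmTraceOn [Module.Finite ℚ E] (Φ : CMTypeOn E) (a : E) : IsIntegral ℚ (cmTraceOn Φ a) := by
  rw [cmTraceOn_apply]
  exact IsIntegral.sum _ fun φ _ => (Algebra.IsIntegral.isIntegral (R := ℚ) a).map φ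

/-- **`E*` is a finite extension of `ℚ`** (a number field inside `ℂ`), for `E` finite over `ℚ`.
[cite: MilneCM2006, Ch. I §1 Def. 1.17] -/
instance finiteDimensional_reflexFieldOn [Module.Finite ℚ E] (Φ : CMTypeOn E) :
    FiniteDimensional ℚ (reflexFieldOn Φ) := by
  let b := Module.finBasis ℚ E
  rw [reflexFieldOn_eq_adjoin_range_basis b]
  haveI : Finite (Set.range fun i => cmTraceOn Φ (b i)) := Set.finite_range _ |>.to_subtype
  exact IntermediateField.finiteDimensional_adjoin fun z hz => by
    obtain ⟨i, rfl⟩ := hz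
    exact isIntegral_cmTraceOn Φ (b i)

/-- `E*` is a number field. [cite: MilneCM2006, Ch. I §1 Def. 1.17] -/
instance numberField_reflexFieldOn [Module.Finite ℚ E] (Φ : CMTypeOn E) : NumberField (reflexFieldOn Φ) where
  to_charZero := charZero_of_injective_algebraMap (algebraMap ℚ (reflexFieldOn Φ)).injective
  to_finiteDimensional := finiteDimensional_reflexFieldOn Φ

end Finite

section CMFieldCase

variable (K : Type) [Field K] [NumberField K] [IsCMField K]

/-- **The complex reflex field of a CM type of a CM FIELD is a CM field** (Shimura §8.3 Prop. 28 / Milne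
1.18 (a), field case): the tree's `isCMField_reflexField` (Galois side, inside `K^c`) transported to `ℂ` along
`lift_reflexField_galoisClosure`. [cite: MilneCM2006, Ch. I §1 Prop. 1.18 (a)] [cite: Shimura1998, §8.3 Prop. 28] -/
theorem isCMField_traceField (Φ : CMType K) : IsCMField (traceField Φ) := by
  obtain ⟨φ₀⟩ : Nonempty (K →+* ℂ) := inferInstance
  let R := reflexField ℚ (galoisClosure K) (algValuedIn (algebraMap (galoisClosure K) ℂ) Φ.1)
  have hCM : IsCMField R := isCMField_reflexField (algebraMap (galoisClosure K) ℂ) Φ (corestrict K φ₀.toRatAlgHom)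
  have hlift : IntermediateField.lift R = traceField Φ := lift_reflexField_galoisClosure Φ
  let e : traceField Φ ≃ₐ[ℚ] R :=
    (IntermediateField.equivOfEq hlift.symm).trans (IntermediateField.liftAlgEquiv R).symm
  haveI : FiniteDimensional ℚ (traceField Φ) := LinearEquiv.finiteDimensional e.symm.toLinearEquiv
  haveI : NumberField (traceField Φ) :=
    { to_charZero := charZero_of_injective_algebraMap (algebraMap ℚ (traceField Φ)).injective
      to_finiteDimensional := inferInstance }
  exact isCMField_of_ringEquiv e.toRingEquiv hCM

/-- `E*` of a CM FIELD pair `(K, Φ)` is a CM field. [cite: MilneCM2006, Ch. I §1 Prop. 1.18 (a)] -/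
theorem isCMField_reflexFieldOn_field (Φ : CMType K) : IsCMField (reflexFieldOn (cmTypeEquivCMTypeOn K Φ)) := by
  rw [reflexFieldOn_cmTypeEquivCMTypeOn]
  exact isCMField_traceField K Φ

end CMFieldCase

section CMAlgebraCase

variable {ι : Type} [Fintype ι] {K : ι → Type} [∀ i, Field (K i)] [∀ i, NumberField (K i)]

/-- **PROPOSITION 1.18 (a) for a product of CM fields**: `(∏ᵢ Kᵢ, ⊔ᵢ Ψᵢ)* = ∏ᵢ Kᵢ*` is a CM field (a
compositum of CM fields, the tree's `IntermediateField.isCMField_iSup` = Shimura §18.2 Lemma (ii); the index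
set must be non-empty: for the zero algebra `E* = ℚ`). [cite: MilneCM2006, Ch. I §1 Prop. 1.18 (a)] -/
theorem isCMField_reflexFieldOn_pi [Nonempty ι] (hK : ∀ i, IsCMField (K i)) (Ψ : (i : ι) → CMTypeOn (K i)) :
    IsCMField (reflexFieldOn (cmTypeOnPi Ψ)) := by
  obtain ⟨i₀⟩ := (inferInstance : Nonempty ι)
  rw [reflexFieldOn_cmTypeOnPi]
  have hcm : ∀ i, IsCMField (reflexFieldOn (Ψ i)) := fun i => by
    haveI := hK i
    have h := isCMField_reflexFieldOn_field (K i) ((cmTypeEquivCMTypeOn (K i)).symm (Ψ i))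
    rwa [Equiv.apply_symm_apply] at h
  exact IntermediateField.isCMField_iSup (fun i => Or.inr (hcm i)) (hcm i₀)

variable {E : Type} [CommRing E] [Algebra ℚ E]

/-- **PROPOSITION 1.18 (a): the reflex field `E*` of a CM-pair `(E, Φ)`, `E ≠ 0` a CM ALGEBRA, is a CM field.**
Proof as printed in substance: `E ≅ ∏ᵢ Kᵢ`, `Φ = ⊔ᵢ Φᵢ`, so `E* = ∏ Kᵢ*` by (b), a compositum of the CM fields
`Kᵢ*` (field case: Shimura Prop. 28). [cite: MilneCM2006, Ch. I §1 Prop. 1.18 (a)] -/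
theorem isCMField_reflexFieldOn [Nontrivial E] (hE : IsCMAlgebra E) (Φ : CMTypeOn E) :
    IsCMField (reflexFieldOn Φ) := by
  obtain ⟨ι, _, K, _, _, hK, ⟨e⟩⟩ := hE
  haveI : Nonempty ι := by
    by_contra hι
    rw [not_nonempty_iff] at hι
    haveI := hι
    haveI : Subsingleton ((i : ι) → K i) := inferInstance
    exact not_subsingleton E (e.toEquiv.subsingleton)
  have h1 : reflexFieldOn Φ = reflexFieldOn (cmTypeOnMap e Φ) := (reflexFieldOn_cmTypeOnMap e Φ).symm
  have h2 : cmTypeOnMap e Φ = cmTypeOnPi (cmTypeOnPiEquiv (cmTypeOnMap e Φ)) :=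
    ((cmTypeOnPiEquiv).symm_apply_apply (cmTypeOnMap e Φ)).symm.trans (cmTypeOnPiEquiv_symm_apply _)
  rw [h1, h2]
  exact isCMField_reflexFieldOn_pi hK _

end CMAlgebraCase

/-! ## §5 `σΦ` is again a CM type (footnote 3) and Prop. 1.16 in the form `σΦ = Φ` -/

section AutType

variable {E : Type} [CommRing E] [Algebra ℚ E]

/-- **On a CM algebra, complex conjugation commutes with `Aut(ℂ)` along every embedding** (footnote 3: «because
`E` is CM, `σ(ι(φ a)) = σ(φ(ι_E a)) = …`»): every `ψ : E → ℂ` factors through a CM field `Kᵢ` of `E ≅ ∏ Kᵢ`, where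
this is Shimura §18.2 Lemma (i) (tree `conj_comm_apply_of_isTotallyReal_or_isCMField`).
[cite: MilneCM2006, Ch. I §1 (footnote 3 before Prop. 1.16)] -/
theorem conj_aut_comm_of_isCMAlgebra (hE : IsCMAlgebra E) (ψ : Emb E) (τ : ℂ ≃+* ℂ) (a : E) :
    τ (starRingEnd ℂ (ψ a)) = starRingEnd ℂ (τ (ψ a)) := by
  obtain ⟨ι, _, K, _, _, hK, ⟨e⟩⟩ := hE
  obtain ⟨⟨i, χ⟩, hχ⟩ := sigmaEmb_surjective (embCongr e ψ)
  have hψ : ψ a = χ ((e a) i) := by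
    have := congrArg (fun f : Emb ((i : ι) → K i) => f (e a)) hχ
    simp only [sigmaEmb_apply, embCongr_apply, AlgEquiv.symm_apply_apply] at this
    exact this.symm
  rw [hψ]
  haveI := hK i
  exact conj_comm_apply_of_isTotallyReal_or_isCMField (Or.inr (hK i)) (χ : K i →+* ℂ) τ ((e a) i)

/-- `σ • φ̄ = \overline{σ • φ}` on a CM algebra. [cite: MilneCM2006, Ch. I §1 (footnote 3 before Prop. 1.16)] -/
theorem aut_smul_conjEmb (hE : IsCMAlgebra E) (σ : ℂ ≃ₐ[ℚ] ℂ) (φ : Emb E) :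
    σ • conjEmb φ = conjEmb (σ • φ) := by
  refine AlgHom.ext fun a => ?_
  rw [aut_smul_emb_apply, conjEmb_apply, conjEmb_apply, aut_smul_emb_apply]
  exact conj_aut_comm_of_isCMAlgebra hE φ σ.toRingEquiv a

/-- **`σΦ` is again a CM type on `E`** («If `σ` is an automorphism of `ℂ` (or `ℚ^al`) and `Φ` is a CM-type on a
CM-algebra `E`, then `σΦ` is again a CM-type on `E`», with footnote 3), `σΦ = {σ ∘ φ | φ ∈ Φ}`.
[cite: MilneCM2006, Ch. I §1 (before Prop. 1.16, footnote 3)] -/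
def cmTypeOnAut (hE : IsCMAlgebra E) (σ : ℂ ≃ₐ[ℚ] ℂ) (Φ : CMTypeOn E) : CMTypeOn E where
  Φ := Φ.Φ.map (MulAction.toPerm σ).toEmbedding
  mem_iff ψ := by
    rw [Finset.mem_map_equiv, Finset.mem_map_equiv, MulAction.toPerm_symm_apply, MulAction.toPerm_symm_apply,
      aut_smul_conjEmb hE]
    exact Φ.mem_iff _

/-- `ψ ∈ σΦ ↔ σ⁻¹ • ψ ∈ Φ`. [cite: MilneCM2006, Ch. I §1 (before Prop. 1.16)] -/
@[simp] theorem mem_cmTypeOnAut_iff (hE : IsCMAlgebra E) (σ : ℂ ≃ₐ[ℚ] ℂ) (Φ : CMTypeOn E) (ψ : Emb E) :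
    ψ ∈ (cmTypeOnAut hE σ Φ).Φ ↔ σ⁻¹ • ψ ∈ Φ.Φ := by
  change ψ ∈ Φ.Φ.map (MulAction.toPerm σ).toEmbedding ↔ _
  rw [Finset.mem_map_equiv, MulAction.toPerm_symm_apply]

/-- As a set of embeddings, `σΦ = σ • Φ`. [cite: MilneCM2006, Ch. I §1 (before Prop. 1.16)] -/
theorem coe_cmTypeOnAut (hE : IsCMAlgebra E) (σ : ℂ ≃ₐ[ℚ] ℂ) (Φ : CMTypeOn E) :
    ((cmTypeOnAut hE σ Φ).Φ : Set (Emb E)) = σ • (Φ.Φ : Set (Emb E)) := by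
  ext ψ
  rw [Finset.mem_coe, mem_cmTypeOnAut_iff, Set.mem_smul_set_iff_inv_smul_mem, Finset.mem_coe]

/-- **PROPOSITION 1.16 (a) with `σΦ` a CM type**: `σ` fixes `E*` pointwise iff `σΦ = Φ`.
[cite: MilneCM2006, Ch. I §1 Prop. 1.16] -/
theorem forall_mem_reflexFieldOn_apply_eq_iff_cmTypeOnAut_eq (hE : IsCMAlgebra E) (Φ : CMTypeOn E)
    (σ : ℂ ≃ₐ[ℚ] ℂ) : (∀ x ∈ reflexFieldOn Φ, σ x = x) ↔ cmTypeOnAut hE σ Φ = Φ := by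
  rw [forall_mem_reflexFieldOn_apply_eq_iff, ← coe_cmTypeOnAut hE, Finset.coe_inj]
  exact ⟨fun h => CMTypeOn.ext' h, fun h => by rw [h]⟩

end AutType

/-! ## §6 PROPOSITION 1.18 (c): the reflex field of an extension -/

section Fixers

/-- **Finite-dimensional subfields of `ℂ` are determined by their pointwise fixers in `Aut(ℂ/ℚ)`**, inclusion
form: if every `σ ∈ Aut(ℂ/ℚ)` fixing `F` pointwise fixes `F′` pointwise, then `F′ ≤ F`.  (For `x ∈ F′ ∖ F` some
`F`-embedding of `F(x)` moves `x`; it extends to an automorphism of `ℂ`, the tree's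
`exists_ringEquiv_apply_eq_algHom`.)  This is the Galois-correspondence step implicit in reading Prop. 1.16 (a) as a
CHARACTERISATION of `E*`. [cite: MilneCM2006, Ch. I §1 Prop. 1.16] -/
theorem _root_.IntermediateField.le_of_forall_algEquiv_fix {F F' : IntermediateField ℚ ℂ}
    [FiniteDimensional ℚ F] [FiniteDimensional ℚ F']
    (h : ∀ σ : ℂ ≃ₐ[ℚ] ℂ, (∀ x ∈ F, σ x = x) → ∀ x ∈ F', σ x = x) : F' ≤ F := by
  intro x hx
  by_contra hxF
  -- `x` is integral over `ℚ`, hence over `F`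
  have hintQ : IsIntegral ℚ x := by
    have h1 : IsIntegral ℚ (⟨x, hx⟩ : F') := Algebra.IsIntegral.isIntegral _
    exact h1.map F'.val
  have hint : IsIntegral F x := hintQ.tower_top
  haveI : FiniteDimensional F F⟮x⟯ := IntermediateField.adjoin.finiteDimensional hint
  -- `[F(x) : F] ≥ 2`
  have hne : Module.finrank F F⟮x⟯ ≠ 1 := by
    rw [Ne, IntermediateField.finrank_adjoin_simple_eq_one_iff, IntermediateField.mem_bot]
    rintro ⟨y, rfl⟩
    exact hxF y.2
  have h2 : 1 < Module.finrank F F⟮x⟯ := by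
    have := Module.finrank_pos (R := F) (M := F⟮x⟯)
    omega
  -- two distinct `F`-embeddings `F(x) → ℂ`, one of which moves `x`
  have hcard : Fintype.card (F⟮x⟯ →ₐ[F] ℂ) = Module.finrank F F⟮x⟯ := AlgHom.card F F⟮x⟯ ℂ
  obtain ⟨ψ₁, ψ₂, hψ⟩ := Fintype.exists_pair_of_one_lt_card (by rw [hcard]; exact h2)
  have hgen : x ∈ F⟮x⟯ := IntermediateField.mem_adjoin_simple_self F x
  obtain ⟨ψ, hψx⟩ : ∃ ψ : F⟮x⟯ →ₐ[F] ℂ, ψ ⟨x, hgen⟩ ≠ x := by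
    by_contra hall
    push Not at hall
    apply hψ
    refine IntermediateField.adjoin_algHom_ext F fun y hy => ?_
    rw [Set.mem_singleton_iff] at hy
    subst hy
    rw [hall ψ₁, hall ψ₂]
  -- extend `ψ` to an automorphism of `ℂ`
  let C : IntermediateField ℚ ℂ := IntermediateField.restrictScalars ℚ F⟮x⟯
  haveI : FiniteDimensional ℚ C := by
    change FiniteDimensional ℚ F⟮x⟯
    exact Module.Finite.trans F F⟮x⟯
  let φ : C.toSubalgebra →ₐ[ℚ] ℂ :=
    { toFun := fun z => ψ ⟨z.1, z.2⟩
      map_one' := map_one ψ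
      map_mul' := fun z w => by rw [← map_mul]; rfl
      map_zero' := map_zero ψ
      map_add' := fun z w => by rw [← map_add]; rfl
      commutes' := fun q => by
        have hq := ψ.commutes (algebraMap ℚ F q)
        rw [IsScalarTower.algebraMap_apply ℚ F ℂ q, ← hq]
        rfl }
  obtain ⟨τ, hτ⟩ := exists_ringEquiv_apply_eq_algHom C φ
  let τ' : ℂ ≃ₐ[ℚ] ℂ := AlgEquiv.ofRingEquiv (f := τ) fun q => by simp
  have hfixF : ∀ y ∈ F, τ' y = y := fun y hy => by
    change τ y = y
    have hyC : y ∈ C := (F⟮x⟯).algebraMap_mem ⟨y, hy⟩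
    rw [hτ y hyC]
    exact ψ.commutes ⟨y, hy⟩
  have hx' := h τ' hfixF x hx
  apply hψx
  change φ ⟨x, hgen⟩ = x
  rw [← hτ x hgen]
  exact hx'

/-- Finite-dimensional subfields of `ℂ` with the same pointwise fixer in `Aut(ℂ/ℚ)` are equal.
[cite: MilneCM2006, Ch. I §1 Prop. 1.16] -/
theorem _root_.IntermediateField.eq_of_forall_algEquiv_fix_iff {F F' : IntermediateField ℚ ℂ}
    [FiniteDimensional ℚ F] [FiniteDimensional ℚ F']
    (h : ∀ σ : ℂ ≃ₐ[ℚ] ℂ, (∀ x ∈ F, σ x = x) ↔ ∀ x ∈ F', σ x = x) : F = F' :=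
  le_antisymm (IntermediateField.le_of_forall_algEquiv_fix fun σ => (h σ).2)
    (IntermediateField.le_of_forall_algEquiv_fix fun σ => (h σ).1)

end Fixers

section Extension

variable {E₀ E : Type} [CommRing E₀] [Algebra ℚ E₀] [CommRing E] [Algebra ℚ E] [Module.Finite ℚ E]

/-- `σ(Φ₀^E) = (σΦ₀)^E` at the level of sets of embeddings: `σ • {φ | φ|E₀ ∈ Φ₀} = {φ | φ|E₀ ∈ σ • Φ₀}`.
[cite: MilneCM2006, Ch. I §1 Prop. 1.18 (c)] -/
theorem smul_coe_cmTypeOnExtend (i : E₀ →ₐ[ℚ] E) (Φ₀ : CMTypeOn E₀) (σ : ℂ ≃ₐ[ℚ] ℂ) :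
    σ • ((cmTypeOnExtend i Φ₀).Φ : Set (Emb E)) = {φ | φ.comp i ∈ σ • (Φ₀.Φ : Set (Emb E₀))} := by
  ext φ
  rw [Set.mem_smul_set_iff_inv_smul_mem, Finset.mem_coe, mem_cmTypeOnExtend_iff, Set.mem_setOf_eq,
    Set.mem_smul_set_iff_inv_smul_mem, Finset.mem_coe]
  exact Iff.rfl

/-- If every embedding of `E₀` extends to `E` (restriction `Hom(E, ℂ) → Hom(E₀, ℂ)` onto — e.g. number fields
`E₀ ⊆ E`, `CMTypeOnSubalgebra.comp_toAlgHom_surjective`), then `σ` stabilises `Φ₀^E` iff it stabilises `Φ₀`.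
[cite: MilneCM2006, Ch. I §1 Prop. 1.18 (c)] -/
theorem smul_coe_cmTypeOnExtend_eq_iff (i : E₀ →ₐ[ℚ] E) (hi : Function.Surjective fun φ : Emb E => φ.comp i)
    (Φ₀ : CMTypeOn E₀) (σ : ℂ ≃ₐ[ℚ] ℂ) :
    σ • ((cmTypeOnExtend i Φ₀).Φ : Set (Emb E)) = (cmTypeOnExtend i Φ₀).Φ ↔
      σ • (Φ₀.Φ : Set (Emb E₀)) = Φ₀.Φ := by
  have hR : ((cmTypeOnExtend i Φ₀).Φ : Set (Emb E)) = {φ | φ.comp i ∈ (Φ₀.Φ : Set (Emb E₀))} := by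
    ext φ
    rw [Finset.mem_coe, mem_cmTypeOnExtend_iff, Set.mem_setOf_eq, Finset.mem_coe]
  rw [smul_coe_cmTypeOnExtend, hR]
  constructor
  · intro h
    ext ψ₀
    obtain ⟨φ, hφ⟩ := hi ψ₀
    have := Set.ext_iff.1 h φ
    simp only [Set.mem_setOf_eq] at this
    rw [← hφ]
    exact this
  · intro h
    rw [h]

/-- **PROPOSITION 1.18 (c)**: «The reflex field of any extension `(E₁, Φ₁)` of `(E, Φ)` equals that of `(E, Φ)`» —
for `Φ₁ = Φ₀^E` the extension of `Φ₀` along `i : E₀ → E`, provided every embedding of `E₀` extends to `E` (the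
standing situation of a CM-subalgebra; for number fields `comp_toAlgHom_surjective`).  Proof as printed,
«`σΦ₁ = Φ₁ ⟺ σΦ = Φ`» (Prop. 1.16 for both pairs), completed by the Galois-correspondence step
`IntermediateField.eq_of_forall_algEquiv_fix_iff`. [cite: MilneCM2006, Ch. I §1 Prop. 1.18 (c)] -/
theorem reflexFieldOn_cmTypeOnExtend [Module.Finite ℚ E₀] (i : E₀ →ₐ[ℚ] E)
    (hi : Function.Surjective fun φ : Emb E => φ.comp i) (Φ₀ : CMTypeOn E₀) :
    reflexFieldOn (cmTypeOnExtend i Φ₀) = reflexFieldOn Φ₀ := by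
  refine IntermediateField.eq_of_forall_algEquiv_fix_iff fun σ => ?_
  rw [forall_mem_reflexFieldOn_apply_eq_iff, forall_mem_reflexFieldOn_apply_eq_iff,
    smul_coe_cmTypeOnExtend_eq_iff i hi]

end Extension

section NumberFields

variable (K L : Type) [Field K] [NumberField K] [Field L] [NumberField L] [Algebra K L]

/-- Prop. 1.18 (c) for number fields `K ⊆ L` on the Gao–Ullmo carrier: `(L, Φ₀^L)* = (K, Φ₀)*`.
[cite: MilneCM2006, Ch. I §1 Prop. 1.18 (c)] -/
theorem reflexFieldOn_cmTypeOnExtend_toAlgHom (Φ₀ : CMTypeOn K) :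
    reflexFieldOn (cmTypeOnExtend (IsScalarTower.toAlgHom ℚ K L) Φ₀) = reflexFieldOn Φ₀ :=
  reflexFieldOn_cmTypeOnExtend _ (comp_toAlgHom_surjective K L) Φ₀

/-- **Prop. 1.18 (c) in the tree's complex vocabulary for number fields**: the complex reflex field
`traceField` of the induced type `Φ^L = inducedCMType (K → L) Φ` (Streng Def. 3.2) equals that of `Φ` — the complex
form of the tree's Galois-side `InducedReflex.reflexField_preimage_restrictEmb` (A3.3.5).
[cite: MilneCM2006, Ch. I §1 Prop. 1.18 (c)] -/
theorem traceField_inducedCMType (Φ : CMType K) :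
    traceField (inducedCMType (algebraMap K L) Φ) = traceField Φ := by
  rw [← reflexFieldOn_cmTypeEquivCMTypeOn, ← reflexFieldOn_cmTypeEquivCMTypeOn, cmTypeEquivCMTypeOn_inducedCMType,
    reflexFieldOn_cmTypeOnExtend_toAlgHom]

end NumberFields

/-! ## §7 Validation: `ℚ(i) × ℚ(i)` -/

section Validation

open CMTypeCount

/-- **`E = ℚ(i) × ℚ(i)`, `Φ = {φ} ⊔ {φ}`: `E* = φ(ℚ(i)) = ℚ(i) ⊂ ℂ`** — by Prop. 1.18 (b) and the field case
(`traceField_single`: the reflex field of `(ℚ(i), {φ})` is `φ(ℚ(i))`), although `E` itself is not a field.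
[cite: MilneCM2006, Ch. I §1 Prop. 1.18 (b)] -/
theorem reflexFieldOn_gaussian_prod (φ : GaussianField →+* ℂ) :
    reflexFieldOn (cmTypeOnProd (cmTypeEquivCMTypeOn GaussianField (gaussianCMType φ))
      (cmTypeEquivCMTypeOn GaussianField (gaussianCMType φ))) = φ.toRatAlgHom.fieldRange := by
  rw [reflexFieldOn_cmTypeOnProd, reflexFieldOn_cmTypeEquivCMTypeOn, traceField_gaussianCMType, sup_idem]

/-- `E* = ℚ(i)` for `ℚ(i) × ℚ(i)` is a CM field (Prop. 1.18 (a) on a non-field CM algebra).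
[cite: MilneCM2006, Ch. I §1 Prop. 1.18 (a)] -/
theorem isCMField_reflexFieldOn_gaussian_prod (Φ : CMTypeOn (GaussianField × GaussianField)) :
    IsCMField (reflexFieldOn Φ) :=
  isCMField_reflexFieldOn isCMAlgebra_gaussian_prod Φ

/-- The diagonal extension `ℚ(i) ⊂ ℚ(i) × ℚ(i)` does not change the reflex field (Prop. 1.18 (c); restriction of
embeddings along the diagonal is onto, Q48's `comp_diagAlgHom_surjective`). [cite: MilneCM2006, Ch. I §1 Prop. 1.18 (c)] -/
theorem reflexFieldOn_cmTypeOnExtend_diag_gaussian (Φ₀ : CMTypeOn GaussianField) :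
    reflexFieldOn (cmTypeOnExtend (diagAlgHom (E := GaussianField)) Φ₀) = reflexFieldOn Φ₀ :=
  reflexFieldOn_cmTypeOnExtend _ comp_diagAlgHom_surjective Φ₀

end Validation

end Literature.NumberTheory.ComplexMultiplication

end
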